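import Literature.MathematicalPhysics.QuantumFieldTheory.Balaban1983to89.T4ReflectionConeSharp
import Literature.MathematicalPhysics.QuantumFieldTheory.Balaban1983to89.BlockAveragingEMLProp2
import HarnessLib

/-!
# S2β ∕ GAP♯∘ strata residue, (RINV-curl) brick (B4a) — THE LADDER LEMMA: the loop `w · e · (w + e)⁻¹ · e⁻¹` swept by a walk `w` and a unit translation `e`
# is within `|w|·δ` of `1` when every plaquette is within `δ` of `1` (any torus `Site P j`, any `GaugeGroup G`; DEFINITION-FREE)

Cell `ym3-torus` (YM ladder rung R3 = continuum `SU(2)` Yang–Mills on the three-torus — a RUNG: NOT d = 4, NOT infinite volume,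
NOT a mass gap, NOT Clay).  Width seat «width 16» `ym3-torus-px16` (gen 21), FREE px helper on crux `stmt-QuantumFields-20520`
(`FluctuationComparisonRegPrIntL`), count-neutral, DEFINITION-FREE (0 `def`, 0 `instance`, 0 `notation`, 0 `sorry`), default heartbeats.

WHY.  On the face-preimage road to (RINV-curl) (bus 13:44Z) the interior defect `I(b) = Ad_{H(b₋)⁻¹}(v̂ − Ad_{W_b} v̂)` of the comb transporter `H` is small because
`W_b = H(b₋)U₀(b)H(b₊)⁻¹` is the holonomy of a THIN loop: the comb path to `b₋`, the bond, the comb path to `b₊` backwards — two parallel staircases one lattice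
unit apart, i.e. a LADDER.  THIS FILE proves the Stokes estimate for ladders on the tree's torus walks (`T4Continuum.walk` ∕ `holAt` ∕ `walkEnd`):
* `unshift_shift_comm`; `dist1_square_le` (the unit square `U(z,κ)U(z+e_κ,ν)U(z+e_ν,κ)⁻¹U(z,ν)⁻¹` is a plaquette, the inverse of one, or `1`);
* ★★`dist1_ladder_le U (hδ : 0 ≤ δ) (hU : ∀ q, dist1 (U(∂q)) ≤ δ) e w z`:
    `dist1 (U(walk z w) · U⟨walkEnd z w, e⟩ · U(walk (z + e) w)⁻¹ · U⟨z, e⟩⁻¹) ≤ |w|·δ`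
  (induction on `w`: peeling the first step conjugates the shorter ladder and multiplies by one unit square; `dist1` is conjugation- and inversion-invariant
  and subadditive, lit `GaugeGroup`).

HONEST SCOPE.  Lattice bookkeeping on the tree's own torus; nothing of Bałaban's analysis is asserted; (B4) (the comb transporter's thin-loop bound), (B5), (D2),
(RINV-curl), MULT♮, AVG₂♭-ax, «CRIT-ax», (D-ax), GAP♯∘ (`stub_uniformFibreGapOrbit`; registry `Lines/semiclassical_s2beta.lean` 3732b7df UNTOUCHED), the five
registered stubs, S2β, crux 20520, 19936, 19200 and `YM3TorusSU2` are NOT proved; no registered stub is closed; the Yang–Mills mass gap is NOT proved.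
Sorry-free, axioms standard.

References: T. Bałaban, CMP **122** (1989) 355–392 [Balaban1989LargeFieldII] (p.382: a tree-gauge bond variable is a loop spanned by plaquettes, «Lemma 1 of
[14]»); CMP **98** (1985) 17–51 [Balaban1985Averaging] ((9) p.19, the plaquette variables).
-/

set_option autoImplicit false

namespace Summit.QuantumFields.YangMills.Theorems.FluctuationComparisonRegPrIntLS2BetaLadderHolonomy

open Literature.MathematicalPhysics.QuantumFieldTheory.Balaban1983to89
open Literature.MathematicalPhysics.QuantumFieldTheory.Balaban1983to89.T4Continuum
open Literature.MathematicalPhysics.QuantumFieldTheory.Balaban1983to89.BlockAveraging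

variable {P : Params} {j : ℕ} {G : Type*} [GaugeGroup G]

/-! ## §1 Site bookkeeping -/

/-- `(x − e_κ) + e_ν = (x + e_ν) − e_κ`. [folklore] -/
theorem unshift_shift_comm (x : Site P j) (κ ν : Fin P.d) : (x.unshift κ).shift ν = (x.shift ν).unshift κ := by
  funext ι
  by_cases h1 : ι = ν <;> by_cases h2 : ι = κ
  · subst h1; subst h2; simp [Site.shift, Site.unshift]
  · subst h1; simp [Site.shift, Site.unshift, Function.update_of_ne h2]
  · subst h2; simp [Site.shift, Site.unshift, Function.update_of_ne h1]
  · simp [Site.shift, Site.unshift, Function.update_of_ne h1, Function.update_of_ne h2]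

/-- The unit square at `z` spanned by `e_κ` (first) and `e_ν`: its holonomy `U(z,κ)U(z+e_κ,ν)U(z+e_ν,κ)⁻¹U(z,ν)⁻¹` is within `δ` of `1` when every plaquette is
(it is a plaquette, the inverse of one, or `1` when `κ = ν`). [cite: Balaban1985Averaging, (9) p.19 (bookkeeping)] -/
theorem dist1_square_le (U : GaugeField P j G) {δ : ℝ} (hδ : 0 ≤ δ) (hU : ∀ q : Plaq P j, dist1 (GaugeField.plaqHol U q) ≤ δ)
    (z : Site P j) (κ ν : Fin P.d) :
    dist1 (U ⟨z, κ⟩ * U ⟨z.shift κ, ν⟩ * (U ⟨z.shift ν, κ⟩)⁻¹ * (U ⟨z, ν⟩)⁻¹) ≤ δ := by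
  rcases lt_trichotomy κ ν with h | h | h
  · exact hU ⟨z, κ, ν, h⟩
  · subst h; rw [mul_inv_cancel_right, mul_inv_cancel, GaugeGroup.dist1_one]; exact hδ
  · have hq := hU ⟨z, ν, κ, h⟩
    rw [← GaugeGroup.dist1_inv] at hq
    refine le_of_eq_of_le (congrArg dist1 ?_) hq
    simp only [GaugeField.plaqHol, mul_inv_rev, inv_inv, mul_assoc]

/-! ## §2 The ladder lemma -/

/-- ★★ **THE LADDER LEMMA.**  For a configuration whose plaquettes are all within `δ ≥ 0` of `1`, a word `w` walked from `z` and from `z + e`, closed by the two rungs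
`⟨walkEnd z w, e⟩` and `⟨z, e⟩`, bounds a loop holonomy within `|w|·δ` of `1`:
  `dist1 (U(walk z w) · U⟨walkEnd z w, e⟩ · U(walk (z+e) w)⁻¹ · U⟨z, e⟩⁻¹) ≤ |w|·δ`
(induction on `w`: peeling the first step conjugates the shorter ladder and multiplies by one unit square).  The Stokes estimate behind every «thin loop» of the
comb transporter. [cite: Balaban1989LargeFieldII, p.382 (Lemma 1 of [14]: a tree-gauge bond is a loop spanned by plaquettes); Balaban1985Averaging, (9) p.19] -/
theorem dist1_ladder_le (U : GaugeField P j G) {δ : ℝ} (hδ : 0 ≤ δ) (hU : ∀ q : Plaq P j, dist1 (GaugeField.plaqHol U q) ≤ δ) (e : Fin P.d) :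
    ∀ (w : List (Letter P.d)) (z : Site P j),
      dist1 (holAt U (walk z w) * U ⟨walkEnd z w, e⟩ * (holAt U (walk (z.shift e) w))⁻¹ * (U ⟨z, e⟩)⁻¹) ≤ w.length * δ
  | [], z => by
    simp only [walk, walkEnd, holAt_nil, one_mul, inv_one, mul_one, mul_inv_cancel, GaugeGroup.dist1_one, List.length_nil, Nat.cast_zero, zero_mul]
    exact le_rfl
  | (κ, true) :: w, z => by
    have ih := dist1_ladder_le U hδ hU e w (z.shift κ)
    simp only [walk, walkEnd, holAt_cons, if_true, List.length_cons, Nat.cast_succ]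
    rw [BlockAveragingEMLProp2.shift_shift_comm z e κ]
    set A := holAt U (walk (z.shift κ) w)
    set B := holAt U (walk ((z.shift κ).shift e) w)
    set y := walkEnd (z.shift κ) w
    have key : U ⟨z, κ⟩ * A * U ⟨y, e⟩ * (U ⟨z.shift e, κ⟩ * B)⁻¹ * (U ⟨z, e⟩)⁻¹ =
        (U ⟨z, κ⟩ * (A * U ⟨y, e⟩ * B⁻¹ * (U ⟨z.shift κ, e⟩)⁻¹) * (U ⟨z, κ⟩)⁻¹) *
          (U ⟨z, κ⟩ * U ⟨z.shift κ, e⟩ * (U ⟨z.shift e, κ⟩)⁻¹ * (U ⟨z, e⟩)⁻¹) := by group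
    rw [key]
    refine (GaugeGroup.dist1_mul_le _ _).trans ?_
    rw [GaugeGroup.dist1_conj, add_mul, one_mul]
    exact add_le_add ih (dist1_square_le U hδ hU z κ e)
  | (κ, false) :: w, z => by
    have ih := dist1_ladder_le U hδ hU e w (z.unshift κ)
    simp only [walk, walkEnd, holAt_cons, List.length_cons, Nat.cast_succ]
    rw [← unshift_shift_comm z κ e]
    set z' := z.unshift κ with hz'
    set A := holAt U (walk z' w)
    set B := holAt U (walk (z'.shift e) w)
    set y := walkEnd z' w
    have hz : z = z'.shift κ := (Site.shift_unshift z κ).symm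
    have key : (U ⟨z', κ⟩)⁻¹ * A * U ⟨y, e⟩ * ((U ⟨z'.shift e, κ⟩)⁻¹ * B)⁻¹ * (U ⟨z, e⟩)⁻¹ =
        ((U ⟨z', κ⟩)⁻¹ * (A * U ⟨y, e⟩ * B⁻¹ * (U ⟨z', e⟩)⁻¹) * ((U ⟨z', κ⟩)⁻¹)⁻¹) *
          ((U ⟨z', κ⟩)⁻¹ * ((U ⟨z', κ⟩ * U ⟨z'.shift κ, e⟩ * (U ⟨z'.shift e, κ⟩)⁻¹ * (U ⟨z', e⟩)⁻¹)⁻¹) * ((U ⟨z', κ⟩)⁻¹)⁻¹) := by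
      rw [hz]; group
    simp only [Bool.false_eq_true, ↓reduceIte]
    rw [key]
    refine (GaugeGroup.dist1_mul_le _ _).trans ?_
    rw [GaugeGroup.dist1_conj, GaugeGroup.dist1_conj, GaugeGroup.dist1_inv, add_mul, one_mul]
    exact add_le_add ih (dist1_square_le U hδ hU z' κ e)

end Summit.QuantumFields.YangMills.Theorems.FluctuationComparisonRegPrIntLS2BetaLadderHolonomy
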